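import Summits.BirchSwinnertonDyer.BirchSwinnertonDyer.Theorems.KatoDescentTamePotSupersingularJetchevIrreducibleCebotarevIrreducible
import Summits.BirchSwinnertonDyer.BirchSwinnertonDyer.Theorems.Rank1ResidualJetCebotarevAdapter
import HarnessLib

/-!
# Crux `JetchevIrreducibleReadingByName` (item 20165), registered stub `stub_thm52RowObjectsAddv`: Jetchev's
# Lemma 6.1 (= [McC] Cor. 3.2) in the localisation currency for an IRREDUCIBLE row at a Heegner field with
# `p ∣ N_E` — the Čebotarev input of the irreducible reading, now UNCONDITIONAL (no `h32I` binder) — seat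
# `bsd-potss-k8t-c4` g9; `--supports 20165`, helper; route-free; nothing booked, no item closed, BSD is not
# proved by any of this

WHAT. g8's `…Thm52AdaptersIrred.exists_kolyvaginPrime_addOrderOf_localization_eq_of_cor32Irred` is Jetchev's
Lemma 6.1 in the `h61` currency of bsd-jet's row theorem, CONDITIONAL on the displayed reading `h32I` ([McC]
Cor. 3.2 with the `p`-adic tower replaced by `W.HasIrreducibleModPGaloisRep p`). This file re-runs it
byte-for-byte with `h32I` REPLACED BY THE THEOREM
`JetchevIrreducibleCebotarev.cor32_localOrder_of_irreducible_of_heegner` (sibling `…CebotarevIrreducible.lean`,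
this seat g9): the price is the two binders that theorem carries — `SatisfiesHeegnerHypothesis
(W.conductorNorm ℤ) K` and `p ∣ W.conductorNorm ℤ` — both held at every use site of the g8 chain (the rows of
the crux are at a Heegner field for `N_E` and an additive `p`). Consumers: `…Thm52RowDataCebotarev`,
`…Thm52KernelInputsCebotarev` (the g8 row / kernel-inputs theorems with `h32I` gone). Why the binders are not
cosmetic: without them the reading is false (dihedral images w.r.t. `K`; see `…CebotarevImage`).

References: [cite: Jetchev2008, Lemma 5.1 (p. 821), Rem. 6.2] [cite: McCallumLMS1991, §3 Cor. 3.2 (p. 299)]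
[cite: Serre1972, §2.6, §5.4].
-/

set_option autoImplicit false
-- the Theorems directory repeats the summit name (sibling precedent `KatoDescentPotSupersingularAssembly.lean`)
set_option linter.dupNamespace false

noncomputable section

open scoped Classical

open WeierstrassCurve IsDedekindDomain NumberField Literature.NumberTheory.EllipticCurves
  Literature.NumberTheory.EllipticCurves.ModularForms Literature.NumberTheory.GaloisRepresentations
  Summit.BirchSwinnertonDyer.Rank1Residual.JET

namespace Summit.BirchSwinnertonDyer.BirchSwinnertonDyer.Theorems.JetchevIrreducibleReadingThm52

/-! ### Lemma 6.1 in the localisation currency, irreducible row, Heegner field, `p ∣ N_E` — unconditional -/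

/-- **[J] Lemma 6.1 (= [McC] Cor. 3.2) in the `h61` currency, for `E[p]` IRREDUCIBLE, `K` Heegner for `N_E`,
`p ∣ N_E` — UNCONDITIONAL**: given a `τ`-eigenclass `x` (sign `e`) and a non-zero eigenclass `y` (sign `−e`)
in `H¹(K, E[p^M])`, there is a Kolyvagin prime `ℓ` outside any finite set, of index `≥ M`, at whose place
both localisations keep their orders. = g8's `exists_kolyvaginPrime_addOrderOf_localization_eq_of_cor32Irred`
byte-for-byte with `h32I …` ↦ `JetchevIrreducibleCebotarev.cor32_localOrder_of_irreducible_of_heegner …`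
(PROVED: Čebotarev + Weil pairing + Serre §2.6 scalar + Minkowski). [cite: Jetchev2008, Lemma 5.1 (p. 821),
Rem. 6.2] [cite: McCallumLMS1991, §3 Cor. 3.2 (p. 299)] -/
theorem exists_kolyvaginPrime_addOrderOf_localization_eq_of_irreducible_of_heegner
    (N : ℕ) [NeZero N] (W : WeierstrassCurve ℚ) [W.IsElliptic] [W.IsGloballyMinimal]
    (hcm : ¬ W.HasCM) (K : Type) [Field K] [NumberField K] (hK : IsImaginaryQuadratic K)
    (hH : SatisfiesHeegnerHypothesis (W.conductorNorm ℤ) K)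
    (p : ℕ) [Fact p.Prime] (hp2 : p ≠ 2) (hirr : W.HasIrreducibleModPGaloisRep p)
    (hpN : p ∣ W.conductorNorm ℤ)
    (τ : K ≃ₐ[ℚ] K) (hτ : τ ≠ 1) (M : ℕ) (hM : 1 ≤ M) {e : ℤ} (he : e = 1 ∨ e = -1)
    (x y : galH1Torsion (W.baseChange K) ((p ^ M : ℕ) : ℤ))
    (hx : conjAct W τ ((p ^ M : ℕ) : ℤ) x = e • x) (hy : conjAct W τ ((p ^ M : ℕ) : ℤ) y = (-e) • y)
    (hy0 : y ≠ 0) (S : Finset ℕ) :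
    ∃ ℓ : ℕ, ℓ ∉ S ∧ Zhang2014.IsKolyvaginPrime N W K p ℓ ∧ M ≤ Zhang2014.kolyvaginIndex W p ℓ ∧
      ∀ v : HeightOneSpectrum (𝓞 K), (ℓ : 𝓞 K) ∈ v.asIdeal →
        addOrderOf (galoisCohomology.localization
            ((W.baseChange K).torsionGaloisModule ((p ^ M : ℕ) : ℤ)) (Sum.inr v) 1 x) = addOrderOf x ∧
        addOrderOf (galoisCohomology.localization
            ((W.baseChange K).torsionGaloisModule ((p ^ M : ℕ) : ℤ)) (Sum.inr v) 1 y) = addOrderOf y := by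
  have hp : p.Prime := Fact.out
  -- every class is killed by `p^M`, so orders are powers of `p` (and prime to `2`)
  have hkill : ∀ z : galH1Torsion (W.baseChange K) ((p ^ M : ℕ) : ℤ), p ^ M • z = 0 := fun z ↦
    galoisCohomology.nsmul_eq_zero_of_forall ((W.baseChange K).torsionGaloisModule ((p ^ M : ℕ) : ℤ))
      (fun T ↦ by
        have h := (W.baseChange K).natAbs_nsmul_geomTorsion T
        rwa [Int.natAbs_natCast] at h) z
  have hordpow : ∀ z : galH1Torsion (W.baseChange K) ((p ^ M : ℕ) : ℤ), ∃ k ≤ M, addOrderOf z = p ^ k :=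
    fun z ↦ (Nat.dvd_prime_pow hp).mp (addOrderOf_dvd_of_nsmul_eq_zero (hkill z))
  have hcop2 : ∀ z : galH1Torsion (W.baseChange K) ((p ^ M : ℕ) : ℤ), (addOrderOf z).Coprime 2 := by
    intro z
    obtain ⟨k, -, hk⟩ := hordpow z
    rw [hk]
    exact Nat.Coprime.pow_left _ ((Nat.coprime_primes hp Nat.prime_two).mpr hp2)
  -- the localisation at the place `v`, typed on `galH1Torsion` (= `galoisCohomology _ 1` by `rfl`)
  let loc : ∀ v : HeightOneSpectrum (𝓞 K), galH1Torsion (W.baseChange K) ((p ^ M : ℕ) : ℤ) →+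
      galoisCohomology (((W.baseChange K).torsionGaloisModule ((p ^ M : ℕ) : ℤ)).toLocal (Sum.inr v)) 1 :=
    fun v ↦ galoisCohomology.localization ((W.baseChange K).torsionGaloisModule ((p ^ M : ℕ) : ℤ))
      (Sum.inr v) 1
  -- dictionary: multiples in `torsionLocalKer` = multiples killed by the localisation
  have hloc : ∀ (v : HeightOneSpectrum (𝓞 K)) (z : galH1Torsion (W.baseChange K) ((p ^ M : ℕ) : ℤ))
      (j : ℕ), loc v (p ^ j • z) = 0 ↔
        ((p ^ j : ℕ) : ℤ) • z ∈ (W.baseChange K).torsionLocalKer (v.adicCompletion K) ((p ^ M : ℕ) : ℤ) := by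
    intro v z j
    haveI : CharZero (v.adicCompletion K) := charZero_of_injective_algebraMap (algebraMap K _).injective
    rw [natCast_zsmul, mem_torsionLocalKer_iff_res_eq_zero (W := W.baseChange K)
      (E := v.adicCompletion K) (pow_ne_zero M hp.ne_zero)]
    exact Iff.rfl
  obtain ⟨b, -, hb⟩ := hordpow y
  have hey : (-e = 1 ∨ -e = -1) := by rcases he with rfl | rfl <;> norm_num
  -- apply Cor 3.2 to an independent system of eigenclasses containing `y` (and `x` if `x ≠ 0`)
  have key : ∃ T : Set ℕ, T.Infinite ∧ ∀ ℓ ∈ T, Zhang2014.IsKolyvaginPrime N W K p ℓ ∧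
      M ≤ Zhang2014.kolyvaginIndex W p ℓ ∧ ∀ v : HeightOneSpectrum (𝓞 K), (ℓ : 𝓞 K) ∈ v.asIdeal →
        addOrderOf (loc v x) = addOrderOf x ∧ addOrderOf (loc v y) = addOrderOf y := by
    by_cases hx0 : x = 0
    · -- the system `(y)`
      have hinf := JetchevIrreducibleCebotarev.cor32_localOrder_of_irreducible_of_heegner N W hcm K hK hH p hp hp2 hirr hpN
        τ hτ M hM 1 ![y]
        (by intro i; fin_cases i; exact hy0)
        (by intro i; fin_cases i; exact ⟨-e, hey, hy⟩)
        (by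
          intro a ha i
          fin_cases i
          have ha' : a 0 • y = 0 := by simpa using ha
          exact addOrderOf_dvd_iff_zsmul_eq_zero.mpr ha')
        ![b] (by intro i; fin_cases i; exact hb) ![b] (fun _ ↦ le_rfl)
      refine ⟨_, hinf, fun ℓ hℓ ↦ ⟨hℓ.2.1, hℓ.2.2.1, fun v hv ↦ ⟨by rw [hx0, map_zero, addOrderOf_zero, addOrderOf_zero], ?_⟩⟩⟩
      rw [hb]
      exact addOrderOf_map_eq_of_forall_map_nsmul_eq_zero_iff (loc v) hp fun j ↦ by
        rw [hloc v y j]; simpa using hℓ.2.2.2 0 v hv j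
    · -- the system `(x, y)`
      obtain ⟨a, -, ha⟩ := hordpow x
      have hinf := JetchevIrreducibleCebotarev.cor32_localOrder_of_irreducible_of_heegner N W hcm K hK hH p hp hp2 hirr hpN
        τ hτ M hM 2 ![x, y]
        (by
          intro i
          fin_cases i
          · exact hx0
          · exact hy0)
        (by
          intro i
          fin_cases i
          · exact ⟨e, he, hx⟩
          · exact ⟨-e, hey, hy⟩)
        (by
          intro c hc i
          have hc' : c 0 • x + c 1 • y = 0 := by simpa [Fin.sum_univ_two] using hc
          obtain ⟨h0, h1⟩ := dvd_of_zsmul_add_zsmul_eq_zero_of_eigen (conjAct W τ ((p ^ M : ℕ) : ℤ)) he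
            hx hy (hcop2 x) (hcop2 y) hc'
          fin_cases i
          · exact h0
          · exact h1)
        ![a, b]
        (by
          intro i
          fin_cases i
          · exact ha
          · exact hb)
        ![a, b] (fun _ ↦ le_rfl)
      refine ⟨_, hinf, fun ℓ hℓ ↦ ⟨hℓ.2.1, hℓ.2.2.1, fun v hv ↦ ⟨?_, ?_⟩⟩⟩
      · rw [ha]
        exact addOrderOf_map_eq_of_forall_map_nsmul_eq_zero_iff (loc v) hp fun j ↦ by
          rw [hloc v x j]; simpa using hℓ.2.2.2 0 v hv j
      · rw [hb]
        exact addOrderOf_map_eq_of_forall_map_nsmul_eq_zero_iff (loc v) hp fun j ↦ by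
          rw [hloc v y j]; simpa using hℓ.2.2.2 1 v hv j
  obtain ⟨T, hT, hTprop⟩ := key
  obtain ⟨ℓ, hℓT, hℓS⟩ := hT.exists_notMem_finset S
  exact ⟨ℓ, hℓS, hTprop ℓ hℓT⟩


end Summit.BirchSwinnertonDyer.BirchSwinnertonDyer.Theorems.JetchevIrreducibleReadingThm52

end
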